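import Summits.ValiantsHypothesis.ValiantsHypothesis.Theorems.PolyaContinuedMonotoneCoverHardWideBet

/-!
# Crux `MonotoneCoverHard` (stmt-ValiantsHypothesis-7421, route PolyaContinued, rank 2) — skeleton of
line `width-wide` (PREPARED by prover val-width-7421-p4 g0, 2026-08-28; NOT registered — registering
it would replace the active line `width_cut` v2, a planner / director decision)

WEAKEST SHARPENING of the registered line `width_cut` v2 (one stub `stub_width` = the width bet): the
bet is assumed only for WIDE covers — some weight-nonzero perfect matching has `≥ 3` variable edges
leaving one row level.  Covers with all widths `≤ 2` satisfy the bet outright (val-width-7421-p2's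
width-two mechanism: `exists_balanced_level`, `varCount_eq`, `belowCount_eq`), and
**`widthBet_of_wideWidthBet : WideWidthBet → WidthBet`**, **`monotoneCoverHard_of_wideWidthBet :
WideWidthBet → MonotoneCoverHard`** (`Theorems/PolyaContinuedMonotoneCoverHardWideBet.lean`,
val-width-7421-p4) record the reduction in kernel.  What is KNOWN about wide covers (all in kernel,
`Theorems/PolyaContinuedMonotoneCoverHard*.lean`): a wide level forces LEVEL-MIXING — every fiber of a
matching over the `≥ 3` label-rows it reads at the wide level contains a matching reading one of them
at another level (`false_of_pure_fiber`), indeed `≥ c²/2 − c` rows above the level do so when the level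
is the lowest (`sq_le_two_mul_card_lateReaders`); the `T`-labels of every `T`-fiber (`#T ≥ 3`) occupy
`≥ #T²/2` rows (`sq_le_two_mul_card_fiberRows`); no set of rows / columns carries a fixed set of `≥ 3`
label-rows / label-columns in all matchings (`no_laneSet_pfaffian_cover` and transposes); the cover is
not row-, column- or label-levelled (`no_quasipolynomial_labelLevelled_cover`'s mechanism); companion
candidate `Lines/width_mixing.lean` states the same stub with "level-mixing" for "wide".

So this skeleton is two lines long: the crux follows BY NAME from the single stub `stub_width_wide`.
First falsifier: ANY label-bijective Pfaffian cover of `per_n`, `n ≥ 3`, with a level of width `≥ 3`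
(refuter `val-width-7421-d1`, `per_3 / per_4`, `m ≤ 12`).  Calibration (honest): `MonotoneCoverHard`
is OPEN, exactly for wide (hence level-mixing) covers; VP ≠ VNP is not moved by this file.
-/

set_option linter.dupNamespace false

namespace Summit.ValiantsHypothesis.ValiantsHypothesis.Cruxes.MonotoneCoverHard.WidthWide

open Summit.ValiantsHypothesis.ValiantsHypothesis.Theses.PolyaContinued
open Summit.ValiantsHypothesis.ValiantsHypothesis.Theorems.PolyaContinuedMonotoneCoverHard
  (monotoneCoverHard_of_wideWidthBet)
open Literature.Computability.AlgebraicComplexity (perPoly)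
open scoped Classical

/-- STUB — THE WIDE WIDTH BET: uniformly (`∃ d n₀`), for every label-bijective Pfaffian cover of
`per_n`, `n ≥ n₀`, on `m + m` vertices, every level function `g` on its used edges, and PROVIDED the
cover is WIDE (some weight-nonzero perfect matching has `≥ 3` variable edges leaving one row level),
some level `h ≥ 1` is balanced with widths `c_h + c_{h-1} ≤ (log₂ m + d)^d`.  (Verbatim the hypothesis
of `monotoneCoverHard_of_wideWidthBet`.) -/
theorem stub_width_wide :
    ∃ d n₀ : ℕ, ∀ (n m : ℕ) (E : Finset (Fin m × Fin m))
  (a : Fin m × Fin m → MvPolynomial (Fin n × Fin n) ℂ), n₀ ≤ n →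
  (∃ s : Fin m × Fin m → ℂ, (∀ e, s e = 1 ∨ s e = -1) ∧
    (Matrix.of fun i j => if (i, j) ∈ E then MvPolynomial.C (s (i, j)) * MvPolynomial.X (i, j)
        else 0 : Matrix (Fin m) (Fin m) (MvPolynomial (Fin m × Fin m) ℂ)).det =
      (Matrix.of fun i j => if (i, j) ∈ E then MvPolynomial.X (i, j) else 0 :
        Matrix (Fin m) (Fin m) (MvPolynomial (Fin m × Fin m) ℂ)).permanent) →
  (∀ e, (∃ j, a e = MvPolynomial.X j) ∨ a e = 0 ∨ a e = 1) →
  perPoly (Fin n) ℂ =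
    MvPolynomial.aeval a (Matrix.of fun i j => if (i, j) ∈ E then MvPolynomial.X (i, j) else 0 :
        Matrix (Fin m) (Fin m) (MvPolynomial (Fin m × Fin m) ℂ)).permanent →
  ∀ g : Fin m ⊕ Fin m → ℕ,
    (∀ τ : Equiv.Perm (Fin m), (∀ i, (i, τ i) ∈ E ∧ a (i, τ i) ≠ 0) → ∀ i,
      (∃ k, a (i, τ i) = MvPolynomial.X k) → g (Sum.inr (τ i)) = g (Sum.inl i) + 1) →
    (∀ τ : Equiv.Perm (Fin m), (∀ i, (i, τ i) ∈ E ∧ a (i, τ i) ≠ 0) → ∀ i,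
      (¬ ∃ k, a (i, τ i) = MvPolynomial.X k) → g (Sum.inr (τ i)) = g (Sum.inl i)) →
    (∃ τ : Equiv.Perm (Fin m), (∀ i, (i, τ i) ∈ E ∧ a (i, τ i) ≠ 0) ∧ ∃ ℓ : ℕ,
      3 ≤ (Finset.univ.filter fun i : Fin m =>
        (∃ k, a (i, τ i) = MvPolynomial.X k) ∧ g (Sum.inl i) = ℓ).card) →
    ∃ h ch cq : ℕ, 1 ≤ h ∧
      (∀ τ : Equiv.Perm (Fin m), (∀ i, (i, τ i) ∈ E ∧ a (i, τ i) ≠ 0) →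
        n ≤ 3 * (Finset.univ.filter fun i : Fin m =>
            (∃ k, a (i, τ i) = MvPolynomial.X k) ∧ g (Sum.inl i) < h).card ∧
          3 * (Finset.univ.filter fun i : Fin m =>
            (∃ k, a (i, τ i) = MvPolynomial.X k) ∧ g (Sum.inl i) < h).card ≤ 2 * n) ∧
      (∀ τ : Equiv.Perm (Fin m), (∀ i, (i, τ i) ∈ E ∧ a (i, τ i) ≠ 0) →
        (Finset.univ.filter fun i : Fin m =>
          (∃ k, a (i, τ i) = MvPolynomial.X k) ∧ g (Sum.inl i) = h).card = ch) ∧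
      (∀ τ : Equiv.Perm (Fin m), (∀ i, (i, τ i) ∈ E ∧ a (i, τ i) ≠ 0) →
        (Finset.univ.filter fun i : Fin m =>
          (∃ k, a (i, τ i) = MvPolynomial.X k) ∧ g (Sum.inl i) = h - 1).card = cq) ∧
      ch + cq ≤ (Nat.log 2 m + d) ^ d := by
  sorry

/-- THE PIECE `MonotoneCoverHard` BY NAME from the single stub. -/
theorem MonotoneCoverHard_of : MonotoneCoverHard :=
  monotoneCoverHard_of_wideWidthBet stub_width_wide

end Summit.ValiantsHypothesis.ValiantsHypothesis.Cruxes.MonotoneCoverHard.WidthWide
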